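import Literature.AnabelianGeometry.SemiGraphs.CoveringGraphApproximators
import Literature.AnabelianGeometry.SemiGraphs.Thm37AtCoveringGraph
import HarnessLib

/-!
# The hypotheses of [SemiAnbd] Thm 3.7 are hereditary for tempered covering graphs of FINITE coherent
# graphs of anabelioids — assembly modulo Galois-countability (route T, T7e partial)

Mochizuki, *Semi-graphs of anabelioids*, Publ. RIMS **42** (2006), §2 Rmk. 2.4.1 p. 26, Def. 2.3 p. 25,
§3 Prop. 3.6 / Thm. 3.7 pp. 38–41 [cite: MochizukiSemiAnbd2006, Rmk 2.4.1 p.26].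

PROOF-ONLY companion (abc-iut cell, L3 route T, file E of abc-iut-L3-d6's T7 plan, PARTIAL: the
Galois-countability field (T2) of the covering graph — file D of the plan — is taken as an explicit
BINDER `hGC`; every other field is discharged by name: abc-iut-L3-d6's `CoveringGraphHypothesesBasic`
(connected / countable / vertex / injective type / slim), abc-iut-L3-t5's `CoveringGraphEstranged`
(aloof, estranged) and `CoveringGraphApproximators` (quasi-coherent over a finite coherent base,
elevated)).  Then, composing with abc-iut-L3-d6's `compactInVerticialAt_coveringGraph_of_finite'`, the
BODY of Thm 3.7 (iii)/(iv) at the covering graph `G_S` of every connected tempered covering `S` of a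
finite coherent Thm-3.7 graph holds modulo `hGC` only (`compactInVerticial_body_coveringGraph_of_finite`).
Nothing here bears on [IUTchIII] Cor. 3.12.
-/

namespace Literature.AnabelianGeometry.SemiGraphs

namespace ProfiniteSemiGraph

namespace CovObj

open Literature.AlgebraicGeometry.Frobenioids (IsConnectedObj)
open Literature.AnabelianGeometry.AbsoluteAnabelian (IsTopologicallyFinitelyGenerated)

universe u

variable {𝒢 : ProfiniteSemiGraph.{u}} (S : CovObj 𝒢)

/-- A connected tempered covering with a point is split, at every point, by ONE finite object with
nonempty fibres (Def. 3.5 (ii) read component-wise + connectedness). [cite: MochizukiSemiAnbd2006, Def 3.5(ii) p.37] -/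
theorem exists_splits_of_isConnectedObj (hS : S.IsTempered)
    (hSc : IsConnectedObj (⟨S, hS⟩ : BTempCat 𝒢)) (p : S.Point) :
    ∃ F : CovObj 𝒢, F.IsFinite ∧ F.HasNonemptyFibres ∧ ∀ q : S.Point, F.SplitsAt S q := by
  obtain ⟨F, hF, hne, hsplit⟩ := hS p
  exact ⟨F, hF, hne, fun q => hsplit q (sameComponent_of_isConnectedObj ⟨S, hS⟩ hSc p q)⟩

/-- **Prop. 3.6's hypotheses for `G_S`, modulo Galois-countability**: `G` a FINITE coherent graph of
anabelioids satisfying the hypotheses of Prop. 3.6, `S` a connected tempered covering with a point over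
some vertex; the (T2) field of `G_S` is the binder `hGC`. [cite: MochizukiSemiAnbd2006, Prop 3.6 p.38] -/
theorem prop36Hypotheses_coveringGraph_of_finite [Finite 𝒢.graph.Vertex] [Finite 𝒢.graph.Edge]
    (h36 : 𝒢.Prop36Hypotheses) (hcoh : 𝒢.IsCoherent) (hS : S.IsTempered)
    (hSc : IsConnectedObj (⟨S, hS⟩ : BTempCat 𝒢)) {v : 𝒢.graph.Vertex} (x : (S.SV v).obj.V)
    (hGC : S.coveringGraph.IsGaloisCountable) : S.coveringGraph.Prop36Hypotheses where
  isConnected := S.isConnected_coveringGraph hS hSc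
  isCountable := S.isCountable_coveringGraph h36.isCountable
  isGaloisCountable := hGC
  hasVertex := S.hasVertex_coveringGraph x
  isOfInjectiveType := S.isOfInjectiveType_coveringGraph h36.isOfInjectiveType
  isQuasiCoherent :=
    S.isQuasiCoherent_coveringGraph_of_finite hcoh.1 (fun v => ⟨hcoh.2.1 v⟩) (fun e => ⟨hcoh.2.2 e⟩)
      (S.exists_splits_of_isConnectedObj hS hSc (Sum.inl ⟨v, x⟩))
  isTotallyElevated := S.isTotallyElevated_coveringGraph h36.isTotallyElevated hS
  isTotallyAloof := S.isTotallyAloof_coveringGraph h36.isTotallyAloof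
  isVerticiallySlim := S.isVerticiallySlim_coveringGraph h36.isVerticiallySlim

/-- **Thm. 3.7's hypotheses for `G_S`, modulo Galois-countability** (same setting, `G` totally
estranged). [cite: MochizukiSemiAnbd2006, Thm 3.7 p.40] -/
theorem thm37Hypotheses_coveringGraph_of_finite [Finite 𝒢.graph.Vertex] [Finite 𝒢.graph.Edge]
    (h37 : 𝒢.Thm37Hypotheses) (hcoh : 𝒢.IsCoherent) (hS : S.IsTempered)
    (hSc : IsConnectedObj (⟨S, hS⟩ : BTempCat 𝒢)) {v : 𝒢.graph.Vertex} (x : (S.SV v).obj.V)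
    (hGC : S.coveringGraph.IsGaloisCountable) : S.coveringGraph.Thm37Hypotheses where
  toProp36Hypotheses := S.prop36Hypotheses_coveringGraph_of_finite h37.toProp36Hypotheses hcoh hS hSc x hGC
  isTotallyEstranged := S.isTotallyEstranged_coveringGraph h37.isTotallyEstranged

/-- **The BODY of [SemiAnbd] Thm 3.7 (iii) at `G_S`**, for every connected tempered covering `S` (with a
vertex point) of a FINITE coherent Thm-3.7 graph of anabelioids, modulo ONLY the Galois-countability of
`G_S`: every compact subgroup of `π₁^temp(G_S)` lies in a verticial subgroup, in at most two, and then
in an edge-like subgroup of a closed edge. [cite: MochizukiSemiAnbd2006, Thm 3.7(iii) pp.40-41] -/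
theorem compactInVerticial_body_coveringGraph_of_finite [Finite 𝒢.graph.Vertex] [Finite 𝒢.graph.Edge]
    (h37 : 𝒢.Thm37Hypotheses) (hcoh : 𝒢.IsCoherent) (hS : S.IsTempered)
    (hSc : IsConnectedObj (⟨S, hS⟩ : BTempCat 𝒢)) {v : 𝒢.graph.Vertex} (x : (S.SV v).obj.V)
    (hGC : S.coveringGraph.IsGaloisCountable) (c : TemperedPiChart S.coveringGraph)
    (C : Subgroup c.G) (hC : IsCompact (C : Set c.G)) :
    (∃ (w : S.coveringGraph.graph.Vertex) (H : Subgroup c.G), H ∈ verticialSubgroups c w ∧ C ≤ H) ∧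
      (C ≠ ⊥ → ∀ (v₁ v₂ : S.coveringGraph.graph.Vertex) (H₁ H₂ : Subgroup c.G),
        H₁ ∈ verticialSubgroups c v₁ → H₂ ∈ verticialSubgroups c v₂ → H₁ ≠ H₂ → C ≤ H₁ → C ≤ H₂ →
          (∀ (v₃ : S.coveringGraph.graph.Vertex) (H₃ : Subgroup c.G),
              H₃ ∈ verticialSubgroups c v₃ → C ≤ H₃ → H₃ = H₁ ∨ H₃ = H₂) ∧
          ∃ (e : S.coveringGraph.graph.Edge) (L : Subgroup c.G), S.coveringGraph.graph.IsClosedEdge e ∧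
            L ∈ edgeLikeSubgroups c e ∧ C ≤ L) :=
  S.compactInVerticialAt_coveringGraph_of_finite' h37 hcoh hS
    (S.thm37Hypotheses_coveringGraph_of_finite h37 hcoh hS hSc x hGC) c C hC

/-- … and the BODY of Thm 3.7 (iv) at `G_S` (maximal compact ⇔ verticial; non-trivial intersections of
two distinct maximal compact subgroups = edge-like subgroups of closed edges), modulo `hGC`.
[cite: MochizukiSemiAnbd2006, Thm 3.7(iv) p.41] -/
theorem maximalCompactIffVerticial_body_coveringGraph_of_finite [Finite 𝒢.graph.Vertex]
    [Finite 𝒢.graph.Edge] (h37 : 𝒢.Thm37Hypotheses) (hcoh : 𝒢.IsCoherent) (hS : S.IsTempered)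
    (hSc : IsConnectedObj (⟨S, hS⟩ : BTempCat 𝒢)) {v : 𝒢.graph.Vertex} (x : (S.SV v).obj.V)
    (hGC : S.coveringGraph.IsGaloisCountable) (c : TemperedPiChart S.coveringGraph) :
    (∀ K : Subgroup c.G, IsMaximalCompactSubgroup K ↔ ∃ w, K ∈ verticialSubgroups c w) ∧
    ∀ L : Subgroup c.G, L ≠ ⊥ →
      ((∃ K₁ K₂ : Subgroup c.G, IsMaximalCompactSubgroup K₁ ∧ IsMaximalCompactSubgroup K₂ ∧
          K₁ ≠ K₂ ∧ L = K₁ ⊓ K₂) ↔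
        ∃ e, S.coveringGraph.graph.IsClosedEdge e ∧ L ∈ edgeLikeSubgroups c e) :=
  S.maximalCompactIffVerticialAt_coveringGraph_of_finite' h37 hcoh hS
    (S.thm37Hypotheses_coveringGraph_of_finite h37 hcoh hS hSc x hGC) c

end CovObj

end ProfiniteSemiGraph

end Literature.AnabelianGeometry.SemiGraphs
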